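import Literature.AlgebraicGeometry.Motives.FamiliesVHS
import Literature.AlgebraicGeometry.Morphisms.EtaleQuasiSectionOfSmooth
import Mathlib.AlgebraicGeometry.Morphisms.Etale
import Mathlib.AlgebraicGeometry.Morphisms.FiniteType
import Mathlib.AlgebraicGeometry.Noetherian
import Mathlib.RingTheory.Artinian.Ring
import Mathlib.RingTheory.Smooth.Local
import Mathlib.RingTheory.Smooth.Locus
import Mathlib.RingTheory.HopkinsLevitzki
import Mathlib.RingTheory.Filtration
import Mathlib.RingTheory.Derivation.ToSquareZero
import Mathlib.RingTheory.FiniteType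
import Mathlib.LinearAlgebra.TensorProduct.Quotient
import HarnessLib

/-!
# EGA IV₄, Prop. 17.14.2 with Cor. 17.16.3 (i): a pointed ÉTALE quasi-section through a point where a morphism
# locally of finite type satisfies the infinitesimal (Artinian, small-extension) lifting criterion

Topic: `Literature/AlgebraicGeometry/Morphisms`. NAMED FACT (D-0014), special case over `ℂ` (all points are
`ℂ`-points, so every residue field is `ℂ` and separability is void), conclusion WEAKER than print (the
«sous-préschéma» `X′ ⊂ X` is recorded as a morphism `τ : T ⟶ X` through the point). Requested by the computation
cell `pub-hsemireg` (run/shared/lean/pub/pub-hsemireg/, theory seat 3, file `theory/TH3-ALGEBRAISATION.md` §8 (D3)–(D4)):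
it is the algebraisation input that turns «formally smooth at the point of the moduli chart» into «an étale
neighbourhood of the base point carrying the family» (consumer: `Summits/Ventures/HSemireg/AmplificationChainVersalChart.lean`).

## Source, verbatim (Publ. Math. IHÉS 32, 1967)

* Prop. (17.14.2), p. 98: «Soient Y un préschéma localement noethérien, f : X → Y un morphisme localement de type
  fini, x un point de X, y = f(x). Pour que f soit lisse (resp. net, resp. étale) au point x, il faut et il suffit
  qu'il vérifie la condition de (17.14.1) (resp. …) où l'on suppose de plus que l'anneau local A′ est artinien,
  que m′𝔍′ = 0, où m′ est l'idéal maximal de A′, et que le corps résiduel A′/m′ de A′ est égal à k(x).»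
  ((17.14.1): for every Y-scheme Spec A′, A′ local, every closed subscheme Y′₀ = Spec(A′/𝔍′) and every Y-morphism
  g₀ : Y′₀ → X with g₀(y′) = x, there is a Y-morphism g : Spec A′ → X extending g₀.)
* Cor. (17.16.3), p. 106: «Soit f : X → S un morphisme lisse. Soient s ∈ S, x un point fermé de X_s tel que le corps
  résiduel k(x) soit séparable sur k(s); alors, dans la conclusion de (17.16.1), on peut prendre X′ tel que le
  morphisme X′ → U, restriction de f, soit étale.» ((17.16.1): «il existe un voisinage ouvert U de s dans S et un
  sous-préschéma X′ ⊂ f⁻¹(U) de X tel que x ∈ X′ …».)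
* [GortzWedhorn2023, Thm. 18.63 (ii)] prints the same infinitesimal criterion with surjections of LOCAL ARTINIAN
  rings with kernel of length 1 (a sub-family of the small extensions below).

## Rendering (binders; every binder is a printed hypothesis or a strengthening of one)

`f : V ⟶ S` a morphism of `ℂ`-schemes (`Motives.SchemeOver ℂ`) with `S` locally noetherian and `f` locally of finite
type (printed: «Y localement noethérien, f localement de type fini»); `v₀` a `ℂ`-point of `V` (printed: «x un point
de X», here with `k(x) = ℂ = k(f x)`, so «A′/m′ = k(x)» reads «A′ is a local Artinian `ℂ`-ALGEBRA with residue field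
`ℂ`», which is automatic for a local Artinian `ℂ`-algebra `A` mapping onto a `B` that has a `ℂ`-point). HYPOTHESIS
= the criterion of (17.14.2) in test-diagram form: for every local Artinian `ℂ`-algebra `A`, every surjection
`φ : A ↠ B` of `ℂ`-algebras with `𝔪_A · ker φ = 0` («m′𝔍′ = 0»; then `B ≅ A/𝔍′`, local with the same residue field),
every `ℂ`-point `ρ` of `B`, every `A`-point `a` of `S` («Spec A′ un Y-schéma») and every `B`-point `b` of `V` CENTRED at
`v₀` (`Spec ρ ≫ b = v₀`: «g₀(y′) = x») lying over `a` (`b ≫ f = Spec φ ≫ a`: «Y-morphisme»), there is an `A`-point `a′` of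
`V` with `Spec φ ≫ a′ = b` and `a′ ≫ f = a` («g prolongeant g₀»). CONCLUSION: a `ℂ`-scheme `T`, a morphism `τ : T ⟶ V`
and a `ℂ`-point `t₀` of `T` with `τ(t₀) = v₀` and `τ ≫ f` ÉTALE — from (17.14.2) (`f` smooth at `v₀`, i.e. on an open
`V′ ∋ v₀`) and (17.16.3)(i) applied to `f|_{V′}` at the closed point `v₀` of its fibre (`T := X′`, `τ` the inclusion,
`τ ≫ f = (X′ → U étale) ≫ (U ↪ S open)` is étale).
-- TODO(general form): arbitrary locally noetherian `Y`, `k(x)` finite separable over `k(f x)`, and `X′` a SUB-PRESCHEME of `X`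
-- (here only a morphism `T ⟶ X` through `x` is recorded).

## References
* [EGAIV4] A. Grothendieck, J. Dieudonné, Éléments de géométrie algébrique IV₄, Publ. Math. IHÉS 32 (1967), Prop.
  17.14.2 (p. 98), 17.16.1, Cor. 17.16.3 (i) (p. 106).
* [GortzWedhorn2023] U. Görtz, T. Wedhorn, Algebraic Geometry II (2023), Thm. 18.63.
-/

noncomputable section

open CategoryTheory AlgebraicGeometry

namespace Literature.AlgebraicGeometry.Morphisms

/-- **EGA IV₄, Prop. 17.14.2 with Cor. 17.16.3 (i)** (`ℂ`-schemes and `ℂ`-points; conclusion weaker than print):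
for `f : V ⟶ S` locally of finite type over a locally noetherian `S` and a `ℂ`-point `v₀` of `V`, IF `f` satisfies the
infinitesimal lifting criterion at `v₀` for all SMALL extensions `φ : A ↠ B` (`𝔪_A · ker φ = 0`) of local Artinian
`ℂ`-algebras, with `B`-points of `V` centred at `v₀`, THEN there are a `ℂ`-scheme `T`, a morphism `τ : T ⟶ V` and a
`ℂ`-point `t₀` of `T` with `τ(t₀) = v₀` and `τ ≫ f` étale («f est lisse au point x» + «on peut prendre X′ tel que le
morphisme X′ → U, restriction de f, soit étale»).
[cite: EGAIV4, Prop. 17.14.2 (p. 98) and Cor. 17.16.3 (i) (p. 106)] [cite: GortzWedhorn2023, Thm. 18.63 (ii)] -/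
def EGAIV_etaleQuasiSection_of_liftsSmallExtensions : Prop :=
  ∀ ⦃V S : Motives.SchemeOver ℂ⦄ (f : V ⟶ S) [IsLocallyNoetherian S.left] [LocallyOfFiniteType f.left]
    (v₀ : Motives.ComplexPoints V),
    (∀ (A B : Type) [CommRing A] [Algebra ℂ A] [IsArtinianRing A] [IsLocalRing A]
        [CommRing B] [Algebra ℂ B] (φ : A →ₐ[ℂ] B), Function.Surjective φ →
        IsLocalRing.maximalIdeal A * RingHom.ker φ = ⊥ →
        ∀ (ρ : B →ₐ[ℂ] ℂ) (a : Motives.specOver ℂ A ⟶ S) (b : Motives.specOver ℂ B ⟶ V),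
          Spec.map (CommRingCat.ofHom ρ.toRingHom) ≫ b.left = v₀.left →
          b.left ≫ f.left = Spec.map (CommRingCat.ofHom φ.toRingHom) ≫ a.left →
          ∃ a' : Motives.specOver ℂ A ⟶ V,
            Spec.map (CommRingCat.ofHom φ.toRingHom) ≫ a'.left = b.left ∧ a' ≫ f = a) →
    ∃ (T : Motives.SchemeOver ℂ) (τ : T ⟶ V) (t₀ : Motives.ComplexPoints T),
      Motives.AlgPoints.map τ t₀ = v₀ ∧ Etale (τ ≫ f).left


/-! ## Appendix (lit-3, pub-hsemireg, appended after landing): the printed test condition of (17.14.1)/(17.14.2) as a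
PREDICATE, Prop. (17.14.2) ALONE as a named fact, and the merged fact `EGAIV_etaleQuasiSection_of_liftsSmallExtensions`
above REDUCED to it in the kernel, using the THEOREM `etaleQuasiSection_of_smooth` = Cor. (17.16.3) (i) proved from
Mathlib in `EtaleQuasiSectionOfSmooth.lean`. Sources as in the module docstring; Déf. (17.3.7), p. 62: «On dit que f
est lisse en un point x ∈ X s'il existe un voisinage ouvert U de x dans X tel que la restriction f|U soit un morphisme
lisse de U dans Y.» (the «smooth on an open `U ∋ v₀`» rendering of «lisse au point x»). The (17.14.1) paraphrase above
omits «h(y′) = y» and «𝔍′ de carré nul»; both are implied under the restrictions of (17.14.2) (`y′ ∈ Y′₀` forces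
`𝔍′ ⊆ m′`, so `𝔍′² ⊆ m′𝔍′ = 0`). -/

open Motives

/-- **The infinitesimal lifting condition of EGA IV₄ (17.14.1) as restricted in (17.14.2), at a `ℂ`-point `v₀`**
of a `ℂ`-scheme `V`, for `f : V ⟶ S`, in test-diagram form: for every local Artinian `ℂ`-algebra `A` («A′ artinien»),
every surjection of `ℂ`-algebras `φ : A ↠ B` with `𝔪_A · ker φ = 0` («sous-schéma fermé Y′₀ = Spec(A′/𝔍′), m′𝔍′ = 0»),
every `ℂ`-point `ρ` of `B`, every `A`-point `a` of `S` («h : Y′ → Y») and every `B`-point `b` of `V` over `a`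
(«Y-morphisme g₀ : Y′₀ → X») centred at `v₀` through `ρ` («g₀(y′) = x», with «A′/m′ = k(x)» automatic since
`k(v₀) = ℂ`), there is an `A`-point `a′` of `V` over `a` restricting to `b` («un Y-morphisme g : Y′ → X dont g₀ soit la
restriction à Y′₀»). Every printed test diagram at `x = v₀` is of this form.
[cite: EGAIV4, Prop. (17.14.1) and Prop. (17.14.2), p. 98] -/
def LiftsAlongSmallExtensionsAt {V S : SchemeOver ℂ} (f : V ⟶ S) (v₀ : ComplexPoints V) : Prop :=
  ∀ (A B : Type) [CommRing A] [Algebra ℂ A] [IsArtinianRing A] [IsLocalRing A]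
    [CommRing B] [Algebra ℂ B] (φ : A →ₐ[ℂ] B), Function.Surjective φ →
    IsLocalRing.maximalIdeal A * RingHom.ker φ = ⊥ →
    ∀ (ρ : B →ₐ[ℂ] ℂ) (a : specOver ℂ A ⟶ S) (b : specOver ℂ B ⟶ V),
      Spec.map (CommRingCat.ofHom ρ.toRingHom) ≫ b.left = v₀.left →
      b.left ≫ f.left = Spec.map (CommRingCat.ofHom φ.toRingHom) ≫ a.left →
      ∃ a' : specOver ℂ A ⟶ V, Spec.map (CommRingCat.ofHom φ.toRingHom) ≫ a'.left = b.left ∧ a' ≫ f = a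

/-- **EGA IV₄, Prop. (17.14.2)** (direction «il suffit», case «lisse», with Déf. (17.3.7) of «lisse au point x»;
`ℂ`-schemes and a `ℂ`-point): let `S` be locally noetherian («Y localement noethérien»), `f : V ⟶ S` locally of
finite type, `v₀` a `ℂ`-point of `V`. If `f` satisfies the lifting condition `LiftsAlongSmallExtensionsAt f v₀`
(local ARTINIAN test rings with residue field `k(v₀) = ℂ` and ideals killed by the maximal ideal), then `f` is smooth
at `v₀`: there is an open `U ∋ v₀` of `V` such that `f|_U` is smooth. [GortzWedhorn2023, Thm. 18.63 (i)⇔(ii)] prints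
the same criterion with small surjections (kernel of length 1), a sub-family of these test diagrams.
-- TODO(general form): any point `x` with the residue-field condition «A′/m′ = k(x)»; the converse; «non ramifié / étale».
[cite: EGAIV4, Prop. (17.14.2), p. 98, with Déf. (17.3.7), p. 62] -/
def EGAIV4_smoothAt_of_liftsAlongSmallExtensions : Prop :=
  ∀ ⦃V S : SchemeOver ℂ⦄ (f : V ⟶ S) [IsLocallyNoetherian S.left] [LocallyOfFiniteType f.left]
    (v₀ : ComplexPoints V), LiftsAlongSmallExtensionsAt f v₀ →
    ∃ U : V.left.Opens, v₀.pt ∈ U ∧ Smooth (U.ι ≫ f.left)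

/-- The image of (the one-point space) `Spec ℂ` under a `ℂ`-point `P` of `X` is contained in any open `U ∋ P.pt`
(`P.pt` is that image by definition of Mathlib `Scheme.SpecToEquivOfField`; private plumbing for the glued
corollary). [folklore] -/
private theorem AlgPoints_range_subset_of_pt_mem {X : SchemeOver ℂ} (P : ComplexPoints X) {U : X.left.Opens}
    (h : P.pt ∈ U) : Set.range P.left ⊆ Set.range U.ι := by
  rintro _ ⟨y, rfl⟩
  rw [Scheme.Opens.range_ι]
  obtain rfl : y = IsLocalRing.closedPoint ℂ := Subsingleton.elim (α := PrimeSpectrum ℂ) _ _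
  exact h

/-- **EGA IV₄ (17.14.2) + (17.16.3) (i), glued, with the test condition as the predicate**
(the shape consumed by the `pub-hsemireg` amplification chain;
`ℂ`-schemes and `ℂ`-points): for `f : V ⟶ S` locally of finite type over a locally noetherian `S` and a `ℂ`-point
`v₀` of `V` at which `f` satisfies the Artinian small-extension lifting condition, there are a `ℂ`-scheme `T`, a
morphism `τ : T ⟶ V` and a `ℂ`-point `t₀` of `T` with `τ(t₀) = v₀` and `τ ≫ f` ÉTALE. PROVED from the named
fact (17.14.2) and the theorem `etaleQuasiSection_of_smooth` ((17.16.3) (i)): (17.14.2) gives an open `U ∋ v₀` with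
`f|_U` smooth; the `ℂ`-point `v₀` lifts to `U`; (17.16.3) (i) applied to `f|_U : U ⟶ S` gives `T ⟶ U`, composed
with `U ↪ V`.
[cite: EGAIV4, Prop. (17.14.2), p. 98, and Cor. (17.16.3) (i), p. 106] -/
theorem etaleQuasiSection_of_liftsAlongSmallExtensionsAt
    (hA : EGAIV4_smoothAt_of_liftsAlongSmallExtensions)
    ⦃V S : SchemeOver ℂ⦄ (f : V ⟶ S) [IsLocallyNoetherian S.left] [LocallyOfFiniteType f.left]
    (v₀ : ComplexPoints V) (hlift : LiftsAlongSmallExtensionsAt f v₀) :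
    ∃ (T : SchemeOver ℂ) (τ : T ⟶ V) (t₀ : ComplexPoints T),
      AlgPoints.map τ t₀ = v₀ ∧ Etale (τ ≫ f).left := by
  obtain ⟨U, hU, hsm⟩ := hA f v₀ hlift
  -- the open piece `U ⊆ V` as a `ℂ`-scheme, with its inclusion
  let U' : SchemeOver ℂ := Over.mk (U.ι ≫ V.hom)
  let ιU : U' ⟶ V := Over.homMk U.ι rfl
  -- the `ℂ`-point `v₀` factors through `U`
  have hrange : Set.range v₀.left ⊆ Set.range U.ι := AlgPoints_range_subset_of_pt_mem v₀ hU
  -- the lift `Spec ℂ ⟶ U` of `v₀` (universal property of the open immersion `U.ι`)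
  let ℓ : (specOver ℂ ℂ).left ⟶ (U : Scheme) := IsOpenImmersion.lift U.ι v₀.left hrange
  have hℓ : ℓ ≫ U.ι = v₀.left := IsOpenImmersion.lift_fac U.ι v₀.left hrange
  let v₀' : ComplexPoints U' := Over.homMk (ℓ :) (by
    change ℓ ≫ U.ι ≫ V.hom = (specOver ℂ ℂ).hom
    rw [reassoc_of% hℓ]
    exact Over.w v₀)
  have hv₀' : AlgPoints.map ιU v₀' = v₀ := by
    ext : 1
    exact hℓ
  -- `f|_U = ιU ≫ f` is smooth
  haveI : Smooth (ιU ≫ f).left := hsm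
  obtain ⟨T, τ, t₀, ht₀, -, het⟩ := etaleQuasiSection_of_smooth (ιU ≫ f) v₀'
  refine ⟨T, τ ≫ ιU, t₀, ?_, ?_⟩
  · rw [AlgPoints.map_comp_apply, ht₀, hv₀']
  · simpa only [Category.assoc] using het


/-- **The merged fact above follows from Prop. (17.14.2) alone** (Cor. (17.16.3) (i) being the theorem
`etaleQuasiSection_of_smooth`): a consumer of `EGAIV_etaleQuasiSection_of_liftsSmallExtensions` may feed it
`EGAIV_etaleQuasiSection_of_liftsSmallExtensions_of_smoothAt hA` to make its EGA trust base Prop. (17.14.2) only.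
[cite: EGAIV4, Prop. (17.14.2), p. 98, and Cor. (17.16.3) (i), p. 106] -/
theorem EGAIV_etaleQuasiSection_of_liftsSmallExtensions_of_smoothAt
    (hA : EGAIV4_smoothAt_of_liftsAlongSmallExtensions) : EGAIV_etaleQuasiSection_of_liftsSmallExtensions := by
  intro V S f _ _ v₀ hlift
  exact etaleQuasiSection_of_liftsAlongSmallExtensionsAt hA f v₀ hlift



/-! ## Appendix B (lit-3 gen 10, `pub-hsemireg`): Prop. (17.14.2) PROVED — `EGAIV4_smoothAt_of_liftsAlongSmallExtensions_holds`

The named fact `EGAIV4_smoothAt_of_liftsAlongSmallExtensions` above is now a THEOREM (its declaration stays, D-0014;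
consumers feed `EGAIV4_smoothAt_of_liftsAlongSmallExtensions_holds`), and so is th-3's merged fact
`EGAIV_etaleQuasiSection_of_liftsSmallExtensions` (`EGAIV_etaleQuasiSection_of_liftsSmallExtensions_holds`, through
`EGAIV_etaleQuasiSection_of_liftsSmallExtensions_of_smoothAt`): the EGA inputs of the `pub-hsemireg` amplification
chain (`Summits/Ventures/HSemireg/AmplificationChainVersalChart.lean`) are thereby proved, not posited. EGA proves (17.14.2) through (17.5.1)/(17.14.1) and
0_IV (19.7.1) (formal smoothness ⟺ flat with geometrically regular fibre); we take the shorter road that Mathlib's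
**Jacobian criterion for local algebras** (`Algebra.FormallySmooth.iff_injective_cotangentComplexBaseChange`:
for a presentation `0 → I → P → S → 0` with `P` formally smooth and `Ω[P⁄R]` finite free, `S` is formally smooth iff
`k ⊗ I → k ⊗ Ω[P⁄R]` is injective) opens:

* `formallySmooth_of_surjective_of_lifts` (local algebra): if for every `N` the quotient map
  `S = P⧸I → P⧸(I + 𝔪^{N+1})` lifts along the SMALL surjection `P⧸(𝔪I + 𝔪^{N+1}) ↠ P⧸(I + 𝔪^{N+1})`, then
  `{f ∈ I ∣ df ∈ 𝔪Ω} ⊆ 𝔪I` (`mem_maximalIdeal_mul_ker_of_lifts`: the lift minus the projection is an `R`-derivation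
  `P → (I + 𝔪^{N+1})/(𝔪I + 𝔪^{N+1})`, which factors through `Ω[P⁄R]` and kills `𝔪Ω`, so `f ∈ (𝔪I + 𝔪^{N+1}) ∩ I
  = 𝔪I + 𝔪^{N+1} ∩ I ⊆ 𝔪I` by **Artin–Rees** `Ideal.exists_pow_inf_eq_pow_smul` for `N ≫ 0`), i.e. the Jacobian
  map is injective;
* `formallySmooth_of_artinianLifts_aux` / `isSmoothAt_of_artinianLifts` (finite-type algebra `C` over a noetherian
  `R`, point = kernel `q` of a surjection `π : C ↠ κ` onto a field): the rings `P⧸(𝔪I + 𝔪^{N+1})`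
  (`P = R[X₁,…,Xₙ]_{Q₀} ↠ C_q`) are ARTINIAN LOCAL with residue field `κ`, so an abstract lifting hypothesis over
  Artinian local `R`-algebras `A` with an ideal `J`, `𝔪_A J = 0`, and an augmentation `A⧸J → κ` over `π`, gives
  `Algebra.IsSmoothAt R q`;
* `EGAIV4_smoothAt_of_liftsAlongSmallExtensions_holds` (schemes): on affine opens `W ∋ v₀`, `U ∋ f v₀` the
  `ℂ`-point `v₀` is the surjection `Γ(V, W) ↠ ℂ` with kernel `hW.primeIdealOf v₀`; each abstract test
  `(A, J, g₀, ε)` becomes a test diagram of `LiftsAlongSmallExtensionsAt f v₀` (`Spec A → U ⊆ S`,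
  `Spec (A⧸J) → W ⊆ V`, centred at `v₀` through `ε`), the lift `Spec A → V` lands in `W` (one-point space) and is
  `Spec` of an `R`-algebra lift `Γ(V, W) → A` (`Spec.map_surjective`, `Spec.map_injective`); then
  `formallySmooth_stalkMap_iff` and the open smooth locus `Scheme.Hom.smoothLocus` (`f` is locally of finite
  presentation since `S` is locally noetherian) give an open `U ∋ v₀` with `f|_U` smooth.
No new definition, no new named fact (D-0026); axioms standard. -/

section AppendixB

open TensorProduct IsLocalRing KaehlerDifferential

/-- For a surjective algebra map `P → K` with kernel `Q` and a `P`-module `M`: `1 ⊗ x = 0` in `K ⊗[P] M` iff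
`x ∈ Q • M` (`K ⊗[P] M ≅ M ⧸ QM`, Mathlib `TensorProduct.quotTensorEquivQuotSMul`). [folklore] -/
private theorem one_tmul_eq_zero_iff_mem_ker_smul_top {P K M : Type*} [CommRing P] [CommRing K]
    [Algebra P K] (hK : Function.Surjective (algebraMap P K)) [AddCommGroup M] [Module P M]
    (x : M) :
    (1 : K) ⊗ₜ[P] x = 0 ↔ x ∈ RingHom.ker (algebraMap P K) • (⊤ : Submodule P M) := by
  let e : (P ⧸ RingHom.ker (algebraMap P K)) ≃ₐ[P] K :=
    Ideal.quotientKerAlgEquivOfSurjective (f := Algebra.ofId P K) hK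
  let E : K ⊗[P] M ≃ₗ[P] M ⧸ (RingHom.ker (algebraMap P K) • (⊤ : Submodule P M)) :=
    TensorProduct.congr e.symm.toLinearEquiv (LinearEquiv.refl P M) ≪≫ₗ
      TensorProduct.quotTensorEquivQuotSMul M (RingHom.ker (algebraMap P K))
  have hE : E (1 ⊗ₜ x) = Submodule.Quotient.mk x := by
    simp only [E, LinearEquiv.trans_apply, TensorProduct.congr_tmul, LinearEquiv.refl_apply,
      AlgEquiv.toLinearEquiv_apply, map_one]
    exact TensorProduct.quotTensorEquivQuotSMul_mk_one_tmul _ x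
  rw [← Submodule.Quotient.mk_eq_zero, ← hE, map_eq_zero_iff _ E.injective]

variable {R P S : Type*} [CommRing R] [CommRing P] [CommRing S] [Algebra R P] [Algebra R S]
  [Algebra P S] [IsScalarTower R P S] [IsLocalRing P] [IsLocalRing S] [IsNoetherianRing P]

/-- **Artinian lifts make the Jacobian map injective** (the heart of (17.14.2) on the Mathlib road). `P` local
noetherian with maximal ideal `𝔪`, `P ↠ S` with kernel `I`: if for every `N` the quotient map `S → P⧸(I + 𝔪^{N+1})`
lifts over `R` along the small surjection `P⧸(𝔪I + 𝔪^{N+1}) ↠ P⧸(I + 𝔪^{N+1})`, then every `f ∈ I` with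
`df ∈ 𝔪Ω[P⁄R]` lies in `𝔪I`. The lift minus the projection is an `R`-derivation
`P → (I + 𝔪^{N+1})/(𝔪I + 𝔪^{N+1})` (Mathlib `derivationToSquareZeroOfLift`), which factors through `Ω[P⁄R]` and
kills `𝔪Ω`; so `f ∈ (𝔪I + 𝔪^{N+1}) ∩ I = 𝔪I + (𝔪^{N+1} ∩ I) ⊆ 𝔪I` for `N ≫ 0` by the **Artin–Rees lemma**
(Mathlib `Ideal.exists_pow_inf_eq_pow_smul`). [cite: EGAIV4, Prop. (17.14.2), p. 98 (statement); proof ours] -/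
theorem mem_maximalIdeal_mul_ker_of_lifts
    (H : ∀ N : ℕ, ∃ g : S →ₐ[R] P ⧸ (maximalIdeal P * RingHom.ker (algebraMap P S) ⊔
        maximalIdeal P ^ (N + 1)),
      ∀ x : P, g (algebraMap P S x) - Ideal.Quotient.mk _ x ∈
        (RingHom.ker (algebraMap P S) ⊔ maximalIdeal P ^ (N + 1)).map (Ideal.Quotient.mk _))
    {f : P} (hf : f ∈ RingHom.ker (algebraMap P S))
    (hdf : D R P f ∈ maximalIdeal P • (⊤ : Submodule P Ω[P⁄R])) :
    f ∈ maximalIdeal P * RingHom.ker (algebraMap P S) := by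
  set m := maximalIdeal P with hm_def
  set I := RingHom.ker (algebraMap P S) with hI_def
  have hIm : I ≤ m := by
    refine IsLocalRing.le_maximalIdeal fun htop => ?_
    have h1 : (1 : P) ∈ I := htop ▸ Submodule.mem_top
    rw [hI_def, RingHom.mem_ker, map_one] at h1
    exact one_ne_zero h1
  -- Artin–Rees: `m^(c+1) ∩ I ⊆ m I`
  obtain ⟨c, hc⟩ := Ideal.exists_pow_inf_eq_pow_smul m (I : Submodule P P)
  have hAR : m ^ (c + 1) ⊓ I ≤ m * I := by
    have h := hc (c + 1) (Nat.le_succ c)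
    rw [Nat.add_sub_cancel_left, pow_one, Ideal.smul_eq_mul, Ideal.smul_eq_mul, Ideal.smul_eq_mul,
      Ideal.mul_top, Ideal.mul_top] at h
    rw [h]
    exact Ideal.mul_mono_right inf_le_right
  -- the ideals at level `c`
  set J : Ideal P := m * I ⊔ m ^ (c + 1) with hJ_def
  set K' : Ideal P := I ⊔ m ^ (c + 1) with hK'_def
  have hmK' : m * K' ≤ J := by
    rw [hK'_def, Ideal.mul_sup, hJ_def]
    exact sup_le_sup_left (by rw [← pow_succ']; exact Ideal.pow_le_pow_right (Nat.le_succ _)) _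
  have hK'sq : K' * K' ≤ J := by
    refine (Ideal.mul_mono_left (sup_le hIm (Ideal.pow_le_self (Nat.succ_ne_zero c)))).trans hmK'
  let 𝔎 : Ideal (P ⧸ J) := K'.map (Ideal.Quotient.mk J)
  have h𝔎sq : 𝔎 ^ 2 = ⊥ := by
    rw [← Ideal.map_pow, pow_two, eq_bot_iff, ← Ideal.map_quotient_self J]
    exact Ideal.map_mono hK'sq
  -- elements of `m • 𝔎` vanish in `P ⧸ J`
  have hm𝔎 : ∀ k ∈ m • (⊤ : Submodule P 𝔎), ((k : 𝔎) : P ⧸ J) = 0 := by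
    intro k hk
    induction hk using Submodule.smul_induction_on' with
    | smul r hr n hn =>
      obtain ⟨k', hk', hk'eq⟩ := (Ideal.mem_map_iff_of_surjective (Ideal.Quotient.mk J)
        Ideal.Quotient.mk_surjective).mp n.2
      change r • (n : P ⧸ J) = 0
      rw [Algebra.smul_def, Ideal.Quotient.algebraMap_eq, ← hk'eq, ← map_mul,
        Ideal.Quotient.eq_zero_iff_mem]
      exact hmK' (Ideal.mul_mem_mul hr hk')
    | add x hx y hy ihx ihy =>
      change ((x : 𝔎) : P ⧸ J) + ((y : 𝔎) : P ⧸ J) = 0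
      rw [ihx, ihy, add_zero]
  -- the lift at level `c`; `g ∘ (P → S)` lifts `P → (P ⧸ J) ⧸ 𝔎`, so differs from `P → P ⧸ J` by a derivation
  obtain ⟨g, hg⟩ := H c
  let gt : P →ₐ[R] P ⧸ J := g.comp (IsScalarTower.toAlgHom R P S)
  have e : (Ideal.Quotient.mkₐ R 𝔎).comp gt = IsScalarTower.toAlgHom R P ((P ⧸ J) ⧸ 𝔎) := by
    ext x
    change Ideal.Quotient.mk 𝔎 (g (algebraMap P S x)) =
      Ideal.Quotient.mk 𝔎 (algebraMap P (P ⧸ J) x)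
    rw [Ideal.Quotient.eq, Ideal.Quotient.algebraMap_eq]
    exact hg x
  let δ : Derivation R P 𝔎 := derivationToSquareZeroOfLift 𝔎 h𝔎sq gt e
  have hδf : ((δ f : 𝔎) : P ⧸ J) = - Ideal.Quotient.mk J f := by
    rw [derivationToSquareZeroOfLift_apply, Ideal.Quotient.algebraMap_eq]
    have : gt f = 0 := by
      change g (algebraMap P S f) = 0
      rw [RingHom.mem_ker.mp hf, map_zero]
    rw [this, zero_sub]
  -- factor the derivation through `Ω[P⁄R]`
  let ℓ : Ω[P⁄R] →ₗ[P] 𝔎 := δ.liftKaehlerDifferential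
  have h1 : ℓ (D R P f) ∈ m • (⊤ : Submodule P 𝔎) := by
    have hle : (m • (⊤ : Submodule P Ω[P⁄R])).map ℓ ≤ m • ⊤ := by
      rw [Submodule.map_smul'']
      exact Submodule.smul_mono le_rfl le_top
    exact hle (Submodule.mem_map_of_mem hdf)
  have h2 : Ideal.Quotient.mk J f = 0 := by
    have := hm𝔎 _ h1
    rwa [Derivation.liftKaehlerDifferential_comp_D, hδf, neg_eq_zero] at this
  have h3 : f ∈ (m * I ⊔ m ^ (c + 1)) ⊓ I := ⟨Ideal.Quotient.eq_zero_iff_mem.mp h2, hf⟩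
  rw [sup_inf_assoc_of_le _ (Ideal.mul_le_left : m * I ≤ I)] at h3
  exact (sup_le le_rfl hAR) h3

/-- **Artinian lifts ⟹ formally smooth, local algebras**: `P` a local noetherian formally smooth `R`-algebra with
`Ω[P⁄R]` finite free, `P ↠ S` (`S` local); if for every `N` the quotient map `S → P⧸(I + 𝔪^{N+1})` lifts over `R`
along `P⧸(𝔪I + 𝔪^{N+1}) ↠ P⧸(I + 𝔪^{N+1})`, then `S` is formally smooth over `R`: by
`mem_maximalIdeal_mul_ker_of_lifts` the map `k ⊗ I → k ⊗ Ω[P⁄R]` is injective, which is Mathlib's **Jacobian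
criterion** `Algebra.FormallySmooth.iff_injective_cotangentComplexBaseChange`.
[cite: EGAIV4, Prop. (17.14.2), p. 98 (statement); proof ours] -/
theorem formallySmooth_of_surjective_of_lifts
    [Algebra.FormallySmooth R P] [Module.Free P Ω[P⁄R]] [Module.Finite P Ω[P⁄R]]
    (h₁ : Function.Surjective (algebraMap P S))
    (H : ∀ N : ℕ, ∃ g : S →ₐ[R] P ⧸ (maximalIdeal P * RingHom.ker (algebraMap P S) ⊔
        maximalIdeal P ^ (N + 1)),
      ∀ x : P, g (algebraMap P S x) - Ideal.Quotient.mk _ x ∈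
        (RingHom.ker (algebraMap P S) ⊔ maximalIdeal P ^ (N + 1)).map (Ideal.Quotient.mk _)) :
    Algebra.FormallySmooth R S := by
  set m := maximalIdeal P with hm_def
  set I := RingHom.ker (algebraMap P S) with hI_def
  let K := ResidueField S
  have hPSK : algebraMap P K = (residue S).comp (algebraMap P S) := IsScalarTower.algebraMap_eq P S K
  have hPK : Function.Surjective (algebraMap P K) := by
    rw [hPSK]; exact residue_surjective.comp h₁
  have hkerPK : RingHom.ker (algebraMap P K) = m := by
    have hmax : (RingHom.ker (algebraMap P K)).IsMaximal := by
      rw [hPSK, ← RingHom.comap_ker, IsLocalRing.ker_residue]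
      exact Ideal.comap_isMaximal_of_surjective _ h₁
    exact IsLocalRing.eq_maximalIdeal hmax
  have h₂ : I.FG := IsNoetherian.noetherian I
  have h₃ : maximalIdeal S ≤ RingHom.ker (algebraMap S K) := IsLocalRing.ker_residue.ge
  rw [Algebra.FormallySmooth.iff_injective_cotangentComplexBaseChange P K h₁ h₂ h₃,
    injective_iff_map_eq_zero]
  intro z hz
  obtain ⟨f, rfl⟩ := TensorProduct.mk_surjective (R := P) (M := I) (S := K) hPK z
  rw [TensorProduct.mk_apply, cotangentComplexBaseChange_tmul, one_smul, kerToTensor_apply] at hz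
  dsimp only at hz
  rw [one_tmul_eq_zero_iff_mem_ker_smul_top hPK, hkerPK] at hz
  rw [TensorProduct.mk_apply, one_tmul_eq_zero_iff_mem_ker_smul_top hPK, hkerPK,
    Submodule.mem_smul_top_iff, Ideal.smul_eq_mul]
  exact mem_maximalIdeal_mul_ker_of_lifts H f.2 hz


section PartB

universe u

/-- **Artinian lifts ⟹ formally smooth, presented form** (the algebra behind (17.14.2)): `P` a local noetherian
formally smooth `R`-algebra with `Ω[P⁄R]` finite free and a localization of `T` at `M`; `S = C_q` with `P ↠ S`
compatible with a surjection `ψ : T ↠ C`; `π : C ↠ κ` onto a field with kernel `q`, extended to `πP : P ↠ κ`. If every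
`R`-algebra map `g₀ : C → A⧸J` into a quotient of an ARTINIAN LOCAL `R`-algebra `A` by an ideal `J` with `𝔪_A J = 0`,
augmented over `π` by some `ε : A⧸J → κ`, lifts to `C → A`, then `S` is formally smooth over `R`: the rings
`P⧸(𝔪I + 𝔪^{N+1})` of `formallySmooth_of_surjective_of_lifts` are Artinian local (`𝔪^{N+1} = 0`,
Mathlib `isArtinianRing_iff_isNilpotent_maximalIdeal`) and augmented by `πP`, and a lift `C → P⧸(𝔪I + 𝔪^{N+1})`
extends to `S = C_q` because elements outside `q` go to units.
[cite: EGAIV4, Prop. (17.14.2), p. 98 (statement); proof ours] -/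
theorem formallySmooth_of_artinianLifts_aux
    {R T P S C κ : Type u} [CommRing R] [CommRing T] [CommRing P] [CommRing S] [CommRing C]
    [Field κ] [Algebra R T] [Algebra R P] [Algebra T P] [IsScalarTower R T P]
    [Algebra R S] [Algebra P S] [IsScalarTower R P S] [Algebra R C] [Algebra C S]
    [IsScalarTower R C S] [Algebra R κ] [IsLocalRing P] [IsNoetherianRing P]
    [Algebra.FormallySmooth R P] [Module.Free P Ω[P⁄R]] [Module.Finite P Ω[P⁄R]] [IsLocalRing S]
    (M : Submonoid T) [IsLocalization M P] (q : Ideal C) [q.IsPrime] [IsLocalization.AtPrime S q]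
    (ψ : T →ₐ[R] C) (hψ : Function.Surjective ψ)
    (hPS : ∀ x, algebraMap P S (algebraMap T P x) = algebraMap C S (ψ x))
    (h₁ : Function.Surjective (algebraMap P S))
    (π : C →ₐ[R] κ) (hq : RingHom.ker π.toRingHom = q)
    (πP : P →ₐ[R] κ) (hπP : ∀ x, πP (algebraMap T P x) = π (ψ x))
    (hπP_surj : Function.Surjective πP)
    (H : ∀ (A : Type u) [CommRing A] [Algebra R A] [IsArtinianRing A] [IsLocalRing A]
        (J : Ideal A), maximalIdeal A * J = ⊥ →
        ∀ (g₀ : C →ₐ[R] A ⧸ J) (ε : (A ⧸ J) →ₐ[R] κ), ε.comp g₀ = π →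
        ∃ g : C →ₐ[R] A, (Ideal.Quotient.mkₐ R J).comp g = g₀) :
    Algebra.FormallySmooth R S := by
  refine formallySmooth_of_surjective_of_lifts (R := R) (P := P) (S := S) h₁ fun N => ?_
  -- the Artinian local ring `A = P ⧸ (m I + m^(N+1))` and its square-zero ideal `𝔎`
  set m := maximalIdeal P with hm_def
  set I := RingHom.ker (algebraMap P S) with hI_def
  have hIm : I ≤ m := by
    refine IsLocalRing.le_maximalIdeal fun htop => ?_
    have h1 : (1 : P) ∈ I := htop ▸ Submodule.mem_top
    rw [hI_def, RingHom.mem_ker, map_one] at h1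
    exact one_ne_zero h1
  set J : Ideal P := m * I ⊔ m ^ (N + 1) with hJ_def
  set K' : Ideal P := I ⊔ m ^ (N + 1) with hK'_def
  have hJm : J ≤ m := sup_le Ideal.mul_le_right (Ideal.pow_le_self (Nat.succ_ne_zero N))
  have hK'm : K' ≤ m := sup_le hIm (Ideal.pow_le_self (Nat.succ_ne_zero N))
  have hmK' : m * K' ≤ J := by
    rw [hK'_def, Ideal.mul_sup, hJ_def]
    exact sup_le_sup_left (by rw [← pow_succ']; exact Ideal.pow_le_pow_right (Nat.le_succ _)) _
  have hJtop : J ≠ ⊤ := fun h =>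
    (IsLocalRing.maximalIdeal.isMaximal P).ne_top (top_le_iff.mp (h ▸ hJm))
  haveI : Nontrivial (P ⧸ J) := Ideal.Quotient.nontrivial_iff.mpr hJtop
  haveI : IsLocalRing (P ⧸ J) := .of_surjective' (Ideal.Quotient.mk J) Ideal.Quotient.mk_surjective
  have hmA : maximalIdeal (P ⧸ J) ≤ m.map (Ideal.Quotient.mk J) := by
    intro a ha
    obtain ⟨x, rfl⟩ := Ideal.Quotient.mk_surjective a
    refine Ideal.mem_map_of_mem _ ?_
    by_contra hx
    exact ha ((IsLocalRing.notMem_maximalIdeal.mp hx).map _)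
  have hmApow : maximalIdeal (P ⧸ J) ^ (N + 1) = ⊥ := by
    rw [eq_bot_iff]
    refine (Ideal.pow_right_mono hmA (N + 1)).trans ?_
    rw [← Ideal.map_pow, ← Ideal.map_quotient_self J]
    exact Ideal.map_mono le_sup_right
  haveI : IsArtinianRing (P ⧸ J) :=
    (isArtinianRing_iff_isNilpotent_maximalIdeal (P ⧸ J)).mpr ⟨N + 1, hmApow⟩
  let 𝔎 : Ideal (P ⧸ J) := K'.map (Ideal.Quotient.mk J)
  have hm𝔎 : maximalIdeal (P ⧸ J) * 𝔎 = ⊥ := by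
    rw [eq_bot_iff]
    refine (Ideal.mul_mono_left hmA).trans ?_
    change Ideal.map (Ideal.Quotient.mk J) m * Ideal.map (Ideal.Quotient.mk J) K' ≤ ⊥
    rw [← Ideal.map_mul, ← Ideal.map_quotient_self J]
    exact Ideal.map_mono hmK'
  -- the augmentation `P ⧸ J → κ`, `(P ⧸ J) ⧸ 𝔎 → κ`
  have hkerπP : RingHom.ker πP.toRingHom = m :=
    IsLocalRing.eq_maximalIdeal (RingHom.ker_isMaximal_of_surjective πP.toRingHom hπP_surj)
  have hπPm : ∀ x ∈ m, πP x = 0 := fun x hx => by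
    rw [← hkerπP] at hx; exact hx
  let εA : (P ⧸ J) →ₐ[R] κ := Ideal.Quotient.liftₐ J πP fun x hx => hπPm x (hJm hx)
  let ε : ((P ⧸ J) ⧸ 𝔎) →ₐ[R] κ := Ideal.Quotient.liftₐ 𝔎 εA fun a ha => by
    obtain ⟨x, hx, rfl⟩ := (Ideal.mem_map_iff_of_surjective (Ideal.Quotient.mk J)
      Ideal.Quotient.mk_surjective).mp ha
    exact hπPm x (hK'm hx)
  -- the map `C → (P ⧸ J) ⧸ 𝔎` (through `T ↠ C`)
  let θ : T →ₐ[R] (P ⧸ J) ⧸ 𝔎 :=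
    (Ideal.Quotient.mkₐ R 𝔎).comp ((Ideal.Quotient.mkₐ R J).comp (IsScalarTower.toAlgHom R T P))
  have hθ : RingHom.ker ψ.toRingHom ≤ RingHom.ker θ.toRingHom := by
    intro x hx
    have hxI : algebraMap T P x ∈ I := by
      rw [hI_def, RingHom.mem_ker, hPS, show ψ x = 0 from hx, map_zero]
    change Ideal.Quotient.mk 𝔎 (Ideal.Quotient.mk J (algebraMap T P x)) = 0
    rw [Ideal.Quotient.eq_zero_iff_mem]
    exact Ideal.mem_map_of_mem _ (le_sup_left (a := I) (b := m ^ (N + 1)) hxI)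
  let g₀ : C →ₐ[R] (P ⧸ J) ⧸ 𝔎 := AlgHom.liftOfSurjective ψ hψ θ hθ
  have hg₀ : ∀ x, g₀ (ψ x) = θ x := AlgHom.liftOfSurjective_apply ψ hψ θ hθ
  have hε : ε.comp g₀ = π := by
    refine AlgHom.ext fun c => ?_
    obtain ⟨x, rfl⟩ := hψ c
    rw [AlgHom.comp_apply, hg₀, ← hπP]
    rfl
  -- the lift
  obtain ⟨gA, hgA⟩ := H (P ⧸ J) 𝔎 hm𝔎 g₀ ε hε
  have hgA' : ∀ c, Ideal.Quotient.mk 𝔎 (gA c) = g₀ c := fun c => congr($hgA c)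
  -- extend `gA : C → P ⧸ J` to `S = C_q`
  have hunit : ∀ s : q.primeCompl, IsUnit (gA s) := by
    intro s
    by_contra hs
    have hmem : gA s ∈ maximalIdeal (P ⧸ J) := hs
    have hpow : gA s ^ (N + 1) = 0 := by
      rw [← Ideal.mem_bot, ← hmApow]; exact Ideal.pow_mem_pow hmem _
    have : π s ^ (N + 1) = 0 := by
      rw [← hε, AlgHom.comp_apply, ← hgA', ← map_pow, ← map_pow, hpow, map_zero, map_zero]
    exact s.2 (hq ▸ RingHom.mem_ker.mpr (pow_eq_zero_iff (Nat.succ_ne_zero N) |>.mp this))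
  let g : S →ₐ[R] P ⧸ J := IsLocalization.liftAlgHom (M := q.primeCompl) (f := gA) hunit
  have hg_alg : ∀ c, g (algebraMap C S c) = gA c := fun c => by
    simp [g, IsLocalization.lift_eq]
  refine ⟨g, fun x => ?_⟩
  -- compare the two ring maps `P → (P ⧸ J) ⧸ 𝔎` on `T`
  have key : (Ideal.Quotient.mk 𝔎).comp (g.toRingHom.comp (algebraMap P S)) =
      (Ideal.Quotient.mk 𝔎).comp (Ideal.Quotient.mk J) := by
    refine IsLocalization.ringHom_ext M (RingHom.ext fun y => ?_)
    change Ideal.Quotient.mk 𝔎 (g (algebraMap P S (algebraMap T P y))) =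
      Ideal.Quotient.mk 𝔎 (Ideal.Quotient.mk J (algebraMap T P y))
    rw [hPS, hg_alg, hgA', hg₀]
    rfl
  exact Ideal.Quotient.eq.mp congr($key x)

/-- **Artinian lifts ⟹ smooth at the point, finite-type algebras** ((17.14.2) in commutative algebra): `R`
noetherian, `C` of finite type over `R`, `π : C ↠ κ` a surjection onto a field with kernel the prime `q`. If every
`R`-algebra map `g₀ : C → A⧸J` (`A` an Artinian local `R`-algebra, `𝔪_A J = 0`) augmented over `π` by some
`ε : A⧸J → κ` lifts to `C → A`, then `C` is smooth over `R` at `q` (Mathlib `Algebra.IsSmoothAt`: `C_q` formally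
smooth). Presentation `P = R[X₁,…,Xₙ]_{ψ⁻¹q} ↠ C_q` as in Mathlib `Algebra.FormallySmooth.of_formallySmooth_residueField_tensor`,
then `formallySmooth_of_artinianLifts_aux`. [cite: EGAIV4, Prop. (17.14.2), p. 98; GortzWedhorn2023, Thm. 18.63 (ii)⇒(i)] -/
theorem isSmoothAt_of_artinianLifts {R C κ : Type u} [CommRing R] [IsNoetherianRing R]
    [CommRing C] [Algebra R C] [Algebra.FiniteType R C] [Field κ] [Algebra R κ]
    (π : C →ₐ[R] κ) (hπ : Function.Surjective π) (q : Ideal C) [q.IsPrime]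
    (hq : RingHom.ker π.toRingHom = q)
    (H : ∀ (A : Type u) [CommRing A] [Algebra R A] [IsArtinianRing A] [IsLocalRing A]
        (J : Ideal A), maximalIdeal A * J = ⊥ →
        ∀ (g₀ : C →ₐ[R] A ⧸ J) (ε : (A ⧸ J) →ₐ[R] κ), ε.comp g₀ = π →
        ∃ g : C →ₐ[R] A, (Ideal.Quotient.mkₐ R J).comp g = g₀) :
    Algebra.IsSmoothAt R q := by
  classical
  obtain ⟨n, ψ, hψ⟩ := Algebra.FiniteType.iff_quotient_mvPolynomial''.mp ‹Algebra.FiniteType R C›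
  -- the local rings `S = C_q` and `P = R[X]_{Q₀}`, `Q₀ = ψ⁻¹ q`
  let S := Localization.AtPrime q
  let Q₀ : Ideal (MvPolynomial (Fin n) R) := q.comap ψ
  let P := Localization.AtPrime Q₀
  have hψq : ∀ x : Q₀.primeCompl, ψ x ∉ q := fun x hx => x.2 hx
  have hmemq : ∀ c, π c = 0 → c ∈ q := fun c h => by rw [← hq]; exact h
  -- `P → S`
  let fP : P →ₐ[R] S := IsLocalization.liftAlgHom (M := Q₀.primeCompl)
    (f := (IsScalarTower.toAlgHom R C S).comp ψ) fun x => by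
      simpa using IsLocalization.map_units (M := q.primeCompl) S ⟨ψ x.1, hψq x⟩
  have hfP_alg : ∀ x, fP (algebraMap _ P x) = algebraMap C S (ψ x) := fun x => by
    simp [fP, IsLocalization.lift_eq]
  have hf₁ : Function.Surjective fP := by
    intro y
    obtain ⟨c, ⟨s, hs⟩, rfl⟩ := IsLocalization.exists_mk'_eq q.primeCompl y
    obtain ⟨x, rfl⟩ := hψ c
    obtain ⟨t, rfl⟩ := hψ s
    refine ⟨IsLocalization.mk' (M := Q₀.primeCompl) P x ⟨t, hs⟩, ?_⟩
    simp [fP, IsLocalization.lift_mk', Units.mul_inv_eq_iff_eq_mul, IsUnit.liftRight]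
  algebraize [fP.toRingHom]
  -- `P` is formally smooth over `R` with `Ω[P⁄R]` finite free
  haveI : Algebra.FormallyEtale (MvPolynomial (Fin n) R) P := .of_isLocalization Q₀.primeCompl
  haveI : Algebra.FormallySmooth R P := .comp R (MvPolynomial (Fin n) R) P
  let eΩ := KaehlerDifferential.tensorKaehlerEquivOfFormallyEtale R (MvPolynomial (Fin n) R) P
  haveI : Module.Free P Ω[P⁄R] := .of_equiv eΩ
  haveI : Module.Finite P Ω[P⁄R] := .of_surjective eΩ.toLinearMap eΩ.surjective
  -- the augmentation `P → κ`
  let πP : P →ₐ[R] κ := IsLocalization.liftAlgHom (M := Q₀.primeCompl) (f := π.comp ψ) fun x => by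
    have : π (ψ x.1) ≠ 0 := fun h => hψq x (hmemq _ h)
    simpa using this
  have hπP_alg : ∀ x, πP (algebraMap _ P x) = π (ψ x) := fun x => by
    simp [πP, IsLocalization.lift_eq]
  have hπP_surj : Function.Surjective πP := fun y => by
    obtain ⟨c, rfl⟩ := hπ y
    obtain ⟨x, rfl⟩ := hψ c
    exact ⟨algebraMap _ P x, hπP_alg x⟩
  exact formallySmooth_of_artinianLifts_aux (R := R) (T := MvPolynomial (Fin n) R) (P := P) (S := S)
    Q₀.primeCompl q ψ hψ hfP_alg hf₁ π hq πP hπP_alg hπP_surj H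

end PartB


section PartC

open Motives

/-- The structural morphism of an affine open of a `ℂ`-scheme: `(Spec Γ(X, U) → U ⊆ X → Spec ℂ) = Spec (ℂ → Γ(X, U))`
(Mathlib `IsAffineOpen.SpecMap_appLE_fromSpec` for `X → Spec ℂ`; cf. `Motives.AlgPoints.ofRingHom`). [folklore] -/
private theorem fromSpec_comp_hom_eq (X : SchemeOver ℂ) {U : X.left.Opens} (hU : IsAffineOpen U) :
    hU.fromSpec ≫ X.hom = Spec.map (CommRingCat.ofHom (SchemeOver.scalarRingHom X U)) := by
  have h1 := IsAffineOpen.SpecMap_appLE_fromSpec X.hom (isAffineOpen_top _) hU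
    (V := U) (U := ⊤) le_top
  rw [IsAffineOpen.fromSpec_top, Scheme.isoSpec_Spec_inv, ← Spec.map_comp] at h1
  rw [← h1]
  rfl

/-- The scalars of `Γ(X, U)` are the pull-backs of the scalars of `Γ(Y, V)` along a `ℂ`-morphism
(both come from `Γ(Spec ℂ, 𝒪) = ℂ`; same statement as `Motives.scalarRingHom_eq_appLE`, re-proved here to keep
the imports light). [folklore] -/
private theorem scalarRingHom_eq_appLE' {X Y : SchemeOver ℂ} (f : X ⟶ Y) {V : Y.left.Opens} {U : X.left.Opens}
    (hle : U ≤ f.left ⁻¹ᵁ V) (c : ℂ) :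
    SchemeOver.scalarRingHom X U c = f.left.appLE V U hle (SchemeOver.scalarRingHom Y V c) := by
  rw [SchemeOver.scalarRingHom_apply, SchemeOver.scalarRingHom_apply]
  have h1 : f.left.appLE V U hle (Y.hom.appLE ⊤ V le_top ((Scheme.ΓSpecIso (.of ℂ)).inv c)) =
      (Y.hom.appLE ⊤ V le_top ≫ f.left.appLE V U hle) ((Scheme.ΓSpecIso (.of ℂ)).inv c) := rfl
  rw [h1, Scheme.Hom.appLE_comp_appLE]
  have key : ∀ (g : X.left ⟶ Spec (.of ℂ)) (_ : g = X.hom) (e' : U ≤ g ⁻¹ᵁ ⊤),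
      g.appLE ⊤ U e' = X.hom.appLE ⊤ U le_top := by
    rintro _ rfl _; rfl
  rw [key _ (Over.w f)]

set_option backward.isDefEq.respectTransparency false in
/-- **EGA IV₄, Prop. (17.14.2)** («il suffit», case «lisse», `ℂ`-schemes and a `ℂ`-point) — PROVED: the named fact
`EGAIV4_smoothAt_of_liftsAlongSmallExtensions` holds. Proof (Mathlib road, not EGA's via 0_IV 19.7.1): on affine
opens `W ∋ v₀`, `U ∋ f v₀` the point is a surjection `Γ(V, W) ↠ ℂ` with kernel the prime of `v₀`; the test diagrams
of `LiftsAlongSmallExtensionsAt` over the Artinian local rings `A = P ⧸ (𝔪I + 𝔪^{N+1})` give the abstract lifting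
hypothesis of `isSmoothAt_of_artinianLifts` (Jacobian criterion + Artin–Rees, `formallySmooth_of_surjective_of_lifts`);
hence the stalk map at `v₀` is formally smooth (`formallySmooth_stalkMap_iff`) and `f` is smooth on the open smooth
locus `∋ v₀` (`Scheme.Hom.smoothLocus`). [cite: EGAIV4, Prop. (17.14.2), p. 98, with Déf. (17.3.7), p. 62] -/
theorem EGAIV4_smoothAt_of_liftsAlongSmallExtensions_holds : EGAIV4_smoothAt_of_liftsAlongSmallExtensions := by
  intro V S f _ _ v₀ hlift
  classical
  -- (a) it suffices that the stalk map at `v₀` be formally smooth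
  suffices hst : (f.left.stalkMap v₀.pt).hom.FormallySmooth by
    refine ⟨f.left.smoothLocus, hst, ?_⟩
    rw [← Scheme.Hom.smoothLocus_eq_top_iff, ← Scheme.Hom.preimage_smoothLocus_eq]
    exact Scheme.Opens.ι_preimage_self _
  -- (b) affine opens `U ∋ f v₀`, `W ∋ v₀`, `W ⊆ f⁻¹ U`
  obtain ⟨_, ⟨U, hU, rfl⟩, hxU, -⟩ := S.left.isBasis_affineOpens.exists_subset_of_mem_open
    (Set.mem_univ (AlgPoints.map f v₀).pt) isOpen_univ
  obtain ⟨_, ⟨W, hW, rfl⟩, hxW, hWU⟩ := V.left.isBasis_affineOpens.exists_subset_of_mem_open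
    (show v₀.pt ∈ f.left ⁻¹ᵁ U from hxU) (f.left ⁻¹ᵁ U).2
  haveI : IsNoetherianRing Γ(S.left, U) := IsLocallyNoetherian.component_noetherian ⟨U, hU⟩
  have hft : (f.left.appLE U W hWU).hom.FiniteType := f.left.finiteType_appLE hU hW hWU
  algebraize [(f.left.appLE U W hWU).hom]
  rw [formallySmooth_stalkMap_iff U hU W hW hWU hxW]
  change Algebra.IsSmoothAt Γ(S.left, U) (hW.primeIdealOf ⟨v₀.pt, hxW⟩).asIdeal
  -- (c) the point as a surjection `Γ(V, W) ↠ ℂ` over `Γ(S, U) → ℂ`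
  let πv : Γ(V.left, W) →+* ℂ := v₀.evalRingHom W hxW
  let r : Γ(S.left, U) →+* ℂ := (AlgPoints.map f v₀).evalRingHom U hxU
  letI : Algebra Γ(S.left, U) ℂ := r.toAlgebra
  have hr : ∀ a, πv (f.left.appLE U W hWU a) = r a := fun a => by
    change v₀.eval W hxW (f.left.appLE U W hWU a) = (AlgPoints.map f v₀).eval U hxU a
    rw [Scheme.Hom.appLE, CategoryTheory.comp_apply, AlgPoints.eval_map_homOfLE, AlgPoints.eval_map]
  let π : Γ(V.left, W) →ₐ[Γ(S.left, U)] ℂ := ⟨πv, hr⟩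
  have hπ : Function.Surjective π := fun z =>
    ⟨SchemeOver.scalarRingHom V W z, by
      change v₀.eval W hxW (SchemeOver.scalarRingHom V W z) = z
      rw [AlgPoints.eval_scalarRingHom]; rfl⟩
  have hq : RingHom.ker π.toRingHom = (hW.primeIdealOf ⟨v₀.pt, hxW⟩).asIdeal := by
    ext a
    have key : a ∉ (hW.primeIdealOf ⟨v₀.pt, hxW⟩).asIdeal ↔ v₀.pt ∈ V.left.basicOpen a := by
      rw [← PrimeSpectrum.mem_basicOpen, IsAffineOpen.primeIdealOf, ← hW.fromSpec_preimage_basicOpen,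
        Scheme.Hom.mem_preimage, ← Scheme.Hom.comp_apply, IsAffineOpen.isoSpec_hom,
        IsAffineOpen.toSpecΓ_fromSpec]
      exact Iff.rfl
    rw [RingHom.mem_ker, ← not_iff_not, key, AlgPoints.pt_mem_basicOpen_iff v₀ hxW a]
    exact Iff.rfl
  refine isSmoothAt_of_artinianLifts π hπ _ hq ?_
  -- (d) the lifting property, from `hlift`
  intro A _ _ _ _ J hJ g₀ ε hε
  letI : Algebra ℂ A := ((algebraMap Γ(S.left, U) A).comp (SchemeOver.scalarRingHom S U)).toAlgebra
  haveI : Nontrivial (A ⧸ J) := ε.toRingHom.domain_nontrivial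
  let φ : A →ₐ[ℂ] A ⧸ J := Ideal.Quotient.mkₐ ℂ J
  have hφ : Function.Surjective φ := Ideal.Quotient.mkₐ_surjective ℂ J
  have hφker : IsLocalRing.maximalIdeal A * RingHom.ker φ = ⊥ := by
    have : RingHom.ker φ = J := Ideal.Quotient.mkₐ_ker ℂ J
    rw [this, hJ]
  -- the augmentation as a `ℂ`-algebra map
  let ρ : (A ⧸ J) →ₐ[ℂ] ℂ :=
    { ε.toRingHom with
      commutes' := fun c => by
        change ε (algebraMap ℂ (A ⧸ J) c) = c
        rw [show algebraMap ℂ (A ⧸ J) c = algebraMap Γ(S.left, U) (A ⧸ J) (SchemeOver.scalarRingHom S U c) from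
          rfl, AlgHom.commutes]
        change (AlgPoints.map f v₀).eval U hxU (SchemeOver.scalarRingHom S U c) = c
        rw [AlgPoints.eval_scalarRingHom]; rfl }
  -- the `A`-point of `S` and the `A ⧸ J`-point of `V`
  let a : specOver ℂ A ⟶ S := Over.homMk (Spec.map (CommRingCat.ofHom (algebraMap Γ(S.left, U) A)) ≫ hU.fromSpec) (by
    change (Spec.map (CommRingCat.ofHom (algebraMap Γ(S.left, U) A)) ≫ hU.fromSpec) ≫ S.hom =
      Spec.map (CommRingCat.ofHom (algebraMap ℂ A))
    rw [Category.assoc, fromSpec_comp_hom_eq, ← Spec.map_comp]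
    rfl)
  have hg₀sc : g₀.toRingHom.comp (SchemeOver.scalarRingHom V W) = algebraMap ℂ (A ⧸ J) := by
    ext c
    change g₀ (SchemeOver.scalarRingHom V W c) = algebraMap ℂ (A ⧸ J) c
    rw [scalarRingHom_eq_appLE' f hWU c]
    change g₀ (algebraMap Γ(S.left, U) Γ(V.left, W) (SchemeOver.scalarRingHom S U c)) = _
    rw [AlgHom.commutes]
    rfl
  let b : specOver ℂ (A ⧸ J) ⟶ V :=
    Over.homMk (Spec.map (CommRingCat.ofHom g₀.toRingHom) ≫ hW.fromSpec) (by
      change (Spec.map (CommRingCat.ofHom g₀.toRingHom) ≫ hW.fromSpec) ≫ V.hom =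
        Spec.map (CommRingCat.ofHom (algebraMap ℂ (A ⧸ J)))
      rw [Category.assoc, fromSpec_comp_hom_eq, ← Spec.map_comp, ← hg₀sc]
      rfl)
  -- the two compatibilities of the test diagram
  have hρg₀ : ρ.toRingHom.comp g₀.toRingHom = πv := by
    ext c
    exact congr($hε c)
  have c1 : Spec.map (CommRingCat.ofHom ρ.toRingHom) ≫ b.left = v₀.left := by
    change Spec.map (CommRingCat.ofHom ρ.toRingHom) ≫ Spec.map (CommRingCat.ofHom g₀.toRingHom) ≫
      hW.fromSpec = v₀.left
    rw [← Spec.map_comp_assoc, ← CommRingCat.ofHom_comp, hρg₀]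
    exact AlgPoints.specMap_evalRingHom_fromSpec v₀ hW hxW
  have hg₀R : g₀.toRingHom.comp (f.left.appLE U W hWU).hom =
      (Ideal.Quotient.mk J).comp (algebraMap Γ(S.left, U) A) := by
    ext t
    change g₀ (algebraMap Γ(S.left, U) Γ(V.left, W) t) = Ideal.Quotient.mk J (algebraMap Γ(S.left, U) A t)
    rw [AlgHom.commutes]
    rfl
  have c2 : b.left ≫ f.left = Spec.map (CommRingCat.ofHom φ.toRingHom) ≫ a.left := by
    change (Spec.map (CommRingCat.ofHom g₀.toRingHom) ≫ hW.fromSpec) ≫ f.left =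
      Spec.map (CommRingCat.ofHom (Ideal.Quotient.mk J)) ≫
        Spec.map (CommRingCat.ofHom (algebraMap Γ(S.left, U) A)) ≫ hU.fromSpec
    rw [Category.assoc, ← IsAffineOpen.SpecMap_appLE_fromSpec f.left hU hW hWU, ← Spec.map_comp_assoc,
      ← Spec.map_comp_assoc, ← CommRingCat.ofHom_comp, ← CommRingCat.ofHom_hom (f.left.appLE U W hWU),
      ← CommRingCat.ofHom_comp, hg₀R]
  -- LIFT
  obtain ⟨a', ha'1, ha'2⟩ := hlift A (A ⧸ J) φ hφ hφker ρ a b c1 c2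
  -- (e) `a'` lands in `W`: `Spec A` has a single point, which is hit by `Spec (A ⧸ J)`
  have hsurj : Function.Surjective (Spec.map (CommRingCat.ofHom φ.toRingHom)) := by
    intro x
    obtain ⟨M, hM⟩ := Ideal.exists_maximal (A ⧸ J)
    refine ⟨(⟨M, hM.isPrime⟩ : PrimeSpectrum (A ⧸ J)), PrimeSpectrum.ext ?_⟩
    rw [IsLocalRing.eq_maximalIdeal (IsArtinianRing.isMaximal_of_isPrime x.asIdeal)]
    exact IsLocalRing.eq_maximalIdeal (IsArtinianRing.isMaximal_of_isPrime _)
  have hpt : ∀ x, a'.left x ∈ W := by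
    intro x
    obtain ⟨y, rfl⟩ := hsurj x
    change (Spec.map (CommRingCat.ofHom φ.toRingHom) ≫ a'.left) y ∈ W
    rw [ha'1]
    change hW.fromSpec (Spec.map (CommRingCat.ofHom g₀.toRingHom) y) ∈ W
    have := Set.mem_range_self (f := fun t => hW.fromSpec t)
      (Spec.map (CommRingCat.ofHom g₀.toRingHom) y)
    rwa [hW.range_fromSpec] at this
  have hrange : Set.range a'.left ⊆ Set.range (Scheme.Opens.ι W) := by
    rintro _ ⟨x, rfl⟩
    rw [Scheme.Opens.range_ι]
    exact hpt x
  let ℓ := IsOpenImmersion.lift (Scheme.Opens.ι W) a'.left hrange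
  have hℓ : ℓ ≫ Scheme.Opens.ι W = a'.left := IsOpenImmersion.lift_fac _ a'.left hrange
  obtain ⟨gC, hgC⟩ := Spec.map_surjective (ℓ ≫ hW.isoSpec.hom)
  have hgC' : Spec.map gC ≫ hW.fromSpec = a'.left := by
    rw [hgC, Category.assoc, ← IsAffineOpen.isoSpec_inv_ι, Iso.hom_inv_id_assoc, hℓ]
  -- (f) the ring map `gC : Γ(V, W) → A` is an `R`-algebra lift of `g₀`
  have hR1 : (f.left.appLE U W hWU) ≫ gC = CommRingCat.ofHom (algebraMap Γ(S.left, U) A) := by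
    have h := congr($(ha'2).left)
    change a'.left ≫ f.left = Spec.map (CommRingCat.ofHom (algebraMap Γ(S.left, U) A)) ≫ hU.fromSpec at h
    rw [← hgC', Category.assoc, ← IsAffineOpen.SpecMap_appLE_fromSpec f.left hU hW hWU,
      ← Spec.map_comp_assoc, cancel_mono] at h
    exact Spec.map_injective h
  have hR2 : gC ≫ CommRingCat.ofHom φ.toRingHom = CommRingCat.ofHom g₀.toRingHom := by
    have h := ha'1
    change Spec.map (CommRingCat.ofHom φ.toRingHom) ≫ a'.left =
      Spec.map (CommRingCat.ofHom g₀.toRingHom) ≫ hW.fromSpec at h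
    rw [← hgC', ← Spec.map_comp_assoc, cancel_mono] at h
    exact Spec.map_injective h
  let g : Γ(V.left, W) →ₐ[Γ(S.left, U)] A :=
    ⟨gC.hom, fun t => by
      change gC.hom (f.left.appLE U W hWU t) = algebraMap Γ(S.left, U) A t
      exact congr(($hR1).hom t)⟩
  refine ⟨g, AlgHom.ext fun c => ?_⟩
  exact congr(($hR2).hom c)

/-- The glued corollary `etaleQuasiSection_of_liftsAlongSmallExtensionsAt`, now UNCONDITIONAL: a morphism of
`ℂ`-schemes locally of finite type over a locally noetherian base which satisfies the Artinian small-extension lifting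
condition at a `ℂ`-point `v₀` admits a pointed ÉTALE quasi-section through `v₀`.
[cite: EGAIV4, Prop. (17.14.2), p. 98, and Cor. (17.16.3) (i), p. 106] -/
theorem etaleQuasiSection_of_liftsAlongSmallExtensionsAt' ⦃V S : SchemeOver ℂ⦄ (f : V ⟶ S)
    [IsLocallyNoetherian S.left] [LocallyOfFiniteType f.left] (v₀ : ComplexPoints V)
    (hlift : LiftsAlongSmallExtensionsAt f v₀) :
    ∃ (T : SchemeOver ℂ) (τ : T ⟶ V) (t₀ : ComplexPoints T),
      AlgPoints.map τ t₀ = v₀ ∧ Etale (τ ≫ f).left :=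
  etaleQuasiSection_of_liftsAlongSmallExtensionsAt EGAIV4_smoothAt_of_liftsAlongSmallExtensions_holds f v₀ hlift

/-- **EGA IV₄ (17.14.2) + (17.16.3) (i)** — th-3's merged named fact `EGAIV_etaleQuasiSection_of_liftsSmallExtensions`
(the input of `Summits/Ventures/HSemireg/AmplificationChainVersalChart.lean`) HOLDS: both EGA statements it packages
are now theorems of this file and of `EtaleQuasiSectionOfSmooth.lean`.
[cite: EGAIV4, Prop. (17.14.2), p. 98, and Cor. (17.16.3) (i), p. 106] -/
theorem EGAIV_etaleQuasiSection_of_liftsSmallExtensions_holds : EGAIV_etaleQuasiSection_of_liftsSmallExtensions :=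
  EGAIV_etaleQuasiSection_of_liftsSmallExtensions_of_smoothAt EGAIV4_smoothAt_of_liftsAlongSmallExtensions_holds

end PartC

end AppendixB

end Literature.AlgebraicGeometry.Morphisms

end
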